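import Mathlib
import Literature.AlgebraicGeometry.HodgeTheory.FermatHodgeCharacters
import Literature.AlgebraicGeometry.HodgeTheory.FermatShiodaCondition
import Summits.HodgeConjecture.FermatCycles.KummerSupportThirtyThree
import HarnessLib

/-!
# Fermat cycles — (4, 33): the classification C1 of Hodge characters with entries `≡ 1 (mod 3)`, kernel proof

HONEST FRAMING: explicit algebraic cycles for specific Hodge classes on Fermat/Delsarte varieties;
residual open instances listed; no claim on general Hodge.

Companion of `KummerSupportThirtyThree` (p355973) and of the cell file `ftc/certs/CONTROL33/CONTROL33.md` §1 (C1, CERT×3 there).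
**C1 (residue 1).** A Hodge character `b : Fin 6 → ℤ/33` of `X⁴₃₃` (Shioda's condition at the 20 units) all of whose entries are
`≡ 1 (mod 3)` has as multiset of values one of the four unit multiples of `a₃₃ = (1,4,16,22,25,31)` (`orbit4`) — in fact one of the
two with residue `1`.  Consequence (CONTROL33 THEOREM F, not formalised): a surface inside a cube-selector carrier
`X⁴₃₃ ∩ {x₀⋯x₅ = ω·G(x³)}` can only carry generator lines besides pulled-back plane classes.

Method: reduce to SORTED characters — `b ∘ σ` for the sorting permutation `σ = Tuple.sort (val ∘ b)` is again a Hodge character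
(`IsHodge.compEquiv`) with the same value multiset, and `b i = 3·q_i + 1` with `q = ⌊val/3⌋` monotone, `q₅ ≤ 10`; monotone `q` are
parametrised WITHOUT repetition by their increments `d₀,…,d₅ ≥ 0`, `Σ d ≤ 10` (`C(16,6) = 8008` tuples, nested bounded quantifiers), over
which the statement is a flat kernel decision.  No new named fact. [cite: Shioda1979HodgeFermat, Thm I (1.6)] for the Hodge test.
-/

open Finset
open Literature.AlgebraicGeometry.HodgeTheory Literature.AlgebraicGeometry.HodgeTheory.FermatCharacter
open Summit.HodgeConjecture.FermatCycles.KummerSupportThirtyThree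

namespace Summit.HodgeConjecture.FermatCycles.KummerSupportThirtyThreeC1

/-- The character with entries `3·q_k + r` (in `ℤ/33`) for residue indices `q : Fin 6 → ℕ`. [folklore] -/
abbrev charOfN (r : ℕ) (q : Fin 6 → ℕ) : Fin 6 → ZMod 33 := fun k ↦ ((3 * q k + r : ℕ) : ZMod 33)

/-- Partial sums of six increments: `q_k = d₀ + ⋯ + d_k`. [folklore] -/
abbrev psum6 (d₀ d₁ d₂ d₃ d₄ d₅ : ℕ) : Fin 6 → ℕ :=
  ![d₀, d₀ + d₁, d₀ + d₁ + d₂, d₀ + d₁ + d₂ + d₃, d₀ + d₁ + d₂ + d₃ + d₄, d₀ + d₁ + d₂ + d₃ + d₄ + d₅]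

set_option maxRecDepth 200000 in set_option maxHeartbeats 80000000 in
set_option synthInstance.maxHeartbeats 2000000 in set_option synthInstance.maxSize 4096 in
/-- Sorted decision, residue 1, first index `q₀ = 0` (increments `d₁..d₅`, `Σ ≤ 10`). Kernel decision. [cite: Shioda1979HodgeFermat, Thm I (1.6)] -/
theorem sorted_decided_one_0 :
    ∀ d₁ < 11, ∀ d₂ < 11 - d₁, ∀ d₃ < 11 - d₁ - d₂, ∀ d₄ < 11 - d₁ - d₂ - d₃, ∀ d₅ < 11 - d₁ - d₂ - d₃ - d₄,
      IsHodge (charOfN 1 (psum6 0 d₁ d₂ d₃ d₄ d₅)) → univ.val.map (charOfN 1 (psum6 0 d₁ d₂ d₃ d₄ d₅)) ∈ orbit4 := by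
  unfold IsHodge IsAdmissible normSum orbit4 charOfN psum6; decide +kernel

set_option maxRecDepth 200000 in set_option maxHeartbeats 80000000 in
set_option synthInstance.maxHeartbeats 2000000 in set_option synthInstance.maxSize 4096 in
/-- Sorted decision, residue 1, first index `q₀ = 1` (increments `d₁..d₅`, `Σ ≤ 9`). Kernel decision. [cite: Shioda1979HodgeFermat, Thm I (1.6)] -/
theorem sorted_decided_one_1 :
    ∀ d₁ < 10, ∀ d₂ < 10 - d₁, ∀ d₃ < 10 - d₁ - d₂, ∀ d₄ < 10 - d₁ - d₂ - d₃, ∀ d₅ < 10 - d₁ - d₂ - d₃ - d₄,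
      IsHodge (charOfN 1 (psum6 1 d₁ d₂ d₃ d₄ d₅)) → univ.val.map (charOfN 1 (psum6 1 d₁ d₂ d₃ d₄ d₅)) ∈ orbit4 := by
  unfold IsHodge IsAdmissible normSum orbit4 charOfN psum6; decide +kernel

set_option maxRecDepth 200000 in set_option maxHeartbeats 80000000 in
set_option synthInstance.maxHeartbeats 2000000 in set_option synthInstance.maxSize 4096 in
/-- Sorted decision, residue 1, first index `q₀ = 2` (increments `d₁..d₅`, `Σ ≤ 8`). Kernel decision. [cite: Shioda1979HodgeFermat, Thm I (1.6)] -/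
theorem sorted_decided_one_2 :
    ∀ d₁ < 9, ∀ d₂ < 9 - d₁, ∀ d₃ < 9 - d₁ - d₂, ∀ d₄ < 9 - d₁ - d₂ - d₃, ∀ d₅ < 9 - d₁ - d₂ - d₃ - d₄,
      IsHodge (charOfN 1 (psum6 2 d₁ d₂ d₃ d₄ d₅)) → univ.val.map (charOfN 1 (psum6 2 d₁ d₂ d₃ d₄ d₅)) ∈ orbit4 := by
  unfold IsHodge IsAdmissible normSum orbit4 charOfN psum6; decide +kernel

set_option maxRecDepth 200000 in set_option maxHeartbeats 80000000 in
set_option synthInstance.maxHeartbeats 2000000 in set_option synthInstance.maxSize 4096 in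
/-- Sorted decision, residue 1, first index `q₀ = 3` (increments `d₁..d₅`, `Σ ≤ 7`). Kernel decision. [cite: Shioda1979HodgeFermat, Thm I (1.6)] -/
theorem sorted_decided_one_3 :
    ∀ d₁ < 8, ∀ d₂ < 8 - d₁, ∀ d₃ < 8 - d₁ - d₂, ∀ d₄ < 8 - d₁ - d₂ - d₃, ∀ d₅ < 8 - d₁ - d₂ - d₃ - d₄,
      IsHodge (charOfN 1 (psum6 3 d₁ d₂ d₃ d₄ d₅)) → univ.val.map (charOfN 1 (psum6 3 d₁ d₂ d₃ d₄ d₅)) ∈ orbit4 := by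
  unfold IsHodge IsAdmissible normSum orbit4 charOfN psum6; decide +kernel

set_option maxRecDepth 200000 in set_option maxHeartbeats 80000000 in
set_option synthInstance.maxHeartbeats 2000000 in set_option synthInstance.maxSize 4096 in
/-- Sorted decision, residue 1, first index `q₀ = 4` (increments `d₁..d₅`, `Σ ≤ 6`). Kernel decision. [cite: Shioda1979HodgeFermat, Thm I (1.6)] -/
theorem sorted_decided_one_4 :
    ∀ d₁ < 7, ∀ d₂ < 7 - d₁, ∀ d₃ < 7 - d₁ - d₂, ∀ d₄ < 7 - d₁ - d₂ - d₃, ∀ d₅ < 7 - d₁ - d₂ - d₃ - d₄,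
      IsHodge (charOfN 1 (psum6 4 d₁ d₂ d₃ d₄ d₅)) → univ.val.map (charOfN 1 (psum6 4 d₁ d₂ d₃ d₄ d₅)) ∈ orbit4 := by
  unfold IsHodge IsAdmissible normSum orbit4 charOfN psum6; decide +kernel

set_option maxRecDepth 200000 in set_option maxHeartbeats 80000000 in
set_option synthInstance.maxHeartbeats 2000000 in set_option synthInstance.maxSize 4096 in
/-- Sorted decision, residue 1, first index `q₀ = 5` (increments `d₁..d₅`, `Σ ≤ 5`). Kernel decision. [cite: Shioda1979HodgeFermat, Thm I (1.6)] -/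
theorem sorted_decided_one_5 :
    ∀ d₁ < 6, ∀ d₂ < 6 - d₁, ∀ d₃ < 6 - d₁ - d₂, ∀ d₄ < 6 - d₁ - d₂ - d₃, ∀ d₅ < 6 - d₁ - d₂ - d₃ - d₄,
      IsHodge (charOfN 1 (psum6 5 d₁ d₂ d₃ d₄ d₅)) → univ.val.map (charOfN 1 (psum6 5 d₁ d₂ d₃ d₄ d₅)) ∈ orbit4 := by
  unfold IsHodge IsAdmissible normSum orbit4 charOfN psum6; decide +kernel

set_option maxRecDepth 200000 in set_option maxHeartbeats 80000000 in
set_option synthInstance.maxHeartbeats 2000000 in set_option synthInstance.maxSize 4096 in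
/-- Sorted decision, residue 1, first index `q₀ = 6` (increments `d₁..d₅`, `Σ ≤ 4`). Kernel decision. [cite: Shioda1979HodgeFermat, Thm I (1.6)] -/
theorem sorted_decided_one_6 :
    ∀ d₁ < 5, ∀ d₂ < 5 - d₁, ∀ d₃ < 5 - d₁ - d₂, ∀ d₄ < 5 - d₁ - d₂ - d₃, ∀ d₅ < 5 - d₁ - d₂ - d₃ - d₄,
      IsHodge (charOfN 1 (psum6 6 d₁ d₂ d₃ d₄ d₅)) → univ.val.map (charOfN 1 (psum6 6 d₁ d₂ d₃ d₄ d₅)) ∈ orbit4 := by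
  unfold IsHodge IsAdmissible normSum orbit4 charOfN psum6; decide +kernel

set_option maxRecDepth 200000 in set_option maxHeartbeats 80000000 in
set_option synthInstance.maxHeartbeats 2000000 in set_option synthInstance.maxSize 4096 in
/-- Sorted decision, residue 1, first index `q₀ = 7` (increments `d₁..d₅`, `Σ ≤ 3`). Kernel decision. [cite: Shioda1979HodgeFermat, Thm I (1.6)] -/
theorem sorted_decided_one_7 :
    ∀ d₁ < 4, ∀ d₂ < 4 - d₁, ∀ d₃ < 4 - d₁ - d₂, ∀ d₄ < 4 - d₁ - d₂ - d₃, ∀ d₅ < 4 - d₁ - d₂ - d₃ - d₄,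
      IsHodge (charOfN 1 (psum6 7 d₁ d₂ d₃ d₄ d₅)) → univ.val.map (charOfN 1 (psum6 7 d₁ d₂ d₃ d₄ d₅)) ∈ orbit4 := by
  unfold IsHodge IsAdmissible normSum orbit4 charOfN psum6; decide +kernel

set_option maxRecDepth 200000 in set_option maxHeartbeats 80000000 in
set_option synthInstance.maxHeartbeats 2000000 in set_option synthInstance.maxSize 4096 in
/-- Sorted decision, residue 1, first index `q₀ = 8` (increments `d₁..d₅`, `Σ ≤ 2`). Kernel decision. [cite: Shioda1979HodgeFermat, Thm I (1.6)] -/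
theorem sorted_decided_one_8 :
    ∀ d₁ < 3, ∀ d₂ < 3 - d₁, ∀ d₃ < 3 - d₁ - d₂, ∀ d₄ < 3 - d₁ - d₂ - d₃, ∀ d₅ < 3 - d₁ - d₂ - d₃ - d₄,
      IsHodge (charOfN 1 (psum6 8 d₁ d₂ d₃ d₄ d₅)) → univ.val.map (charOfN 1 (psum6 8 d₁ d₂ d₃ d₄ d₅)) ∈ orbit4 := by
  unfold IsHodge IsAdmissible normSum orbit4 charOfN psum6; decide +kernel

set_option maxRecDepth 200000 in set_option maxHeartbeats 80000000 in
set_option synthInstance.maxHeartbeats 2000000 in set_option synthInstance.maxSize 4096 in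
/-- Sorted decision, residue 1, first index `q₀ = 9` (increments `d₁..d₅`, `Σ ≤ 1`). Kernel decision. [cite: Shioda1979HodgeFermat, Thm I (1.6)] -/
theorem sorted_decided_one_9 :
    ∀ d₁ < 2, ∀ d₂ < 2 - d₁, ∀ d₃ < 2 - d₁ - d₂, ∀ d₄ < 2 - d₁ - d₂ - d₃, ∀ d₅ < 2 - d₁ - d₂ - d₃ - d₄,
      IsHodge (charOfN 1 (psum6 9 d₁ d₂ d₃ d₄ d₅)) → univ.val.map (charOfN 1 (psum6 9 d₁ d₂ d₃ d₄ d₅)) ∈ orbit4 := by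
  unfold IsHodge IsAdmissible normSum orbit4 charOfN psum6; decide +kernel

set_option maxRecDepth 200000 in set_option maxHeartbeats 80000000 in
set_option synthInstance.maxHeartbeats 2000000 in set_option synthInstance.maxSize 4096 in
/-- Sorted decision, residue 1, first index `q₀ = 10` (increments `d₁..d₅`, `Σ ≤ 0`). Kernel decision. [cite: Shioda1979HodgeFermat, Thm I (1.6)] -/
theorem sorted_decided_one_10 :
    ∀ d₁ < 1, ∀ d₂ < 1 - d₁, ∀ d₃ < 1 - d₁ - d₂, ∀ d₄ < 1 - d₁ - d₂ - d₃, ∀ d₅ < 1 - d₁ - d₂ - d₃ - d₄,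
      IsHodge (charOfN 1 (psum6 10 d₁ d₂ d₃ d₄ d₅)) → univ.val.map (charOfN 1 (psum6 10 d₁ d₂ d₃ d₄ d₅)) ∈ orbit4 := by
  unfold IsHodge IsAdmissible normSum orbit4 charOfN psum6; decide +kernel

set_option maxHeartbeats 8000000 in
/-- SORTED DECISION, residue 1: for all increments `d₀,…,d₅ ≥ 0` with `d₀ + ⋯ + d₅ ≤ 10` (i.e. every monotone `q₀ ≤ ⋯ ≤ q₅ ≤ 10`,
once each: `C(16,6) = 8008` tuples), if `(3q_k + 1)_k` is a Hodge character of `X⁴₃₃` then its value multiset lies in `orbit4`.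
Assembled from the eleven kernel decisions `sorted_decided_one_k` (split by `q₀` to keep each kernel evaluation small).
[cite: Shioda1979HodgeFermat, Thm I (1.6)] -/
theorem sorted_decided_one :
    ∀ d₀ < 11, ∀ d₁ < 11 - d₀, ∀ d₂ < 11 - d₀ - d₁, ∀ d₃ < 11 - d₀ - d₁ - d₂, ∀ d₄ < 11 - d₀ - d₁ - d₂ - d₃,
      ∀ d₅ < 11 - d₀ - d₁ - d₂ - d₃ - d₄,
        IsHodge (charOfN 1 (psum6 d₀ d₁ d₂ d₃ d₄ d₅)) → univ.val.map (charOfN 1 (psum6 d₀ d₁ d₂ d₃ d₄ d₅)) ∈ orbit4 := by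
  intro d₀ hd₀ d₁ hd₁ d₂ hd₂ d₃ hd₃ d₄ hd₄ d₅ hd₅
  interval_cases d₀
  · exact sorted_decided_one_0 d₁ (by omega) d₂ (by omega) d₃ (by omega) d₄ (by omega) d₅ (by omega)
  · exact sorted_decided_one_1 d₁ (by omega) d₂ (by omega) d₃ (by omega) d₄ (by omega) d₅ (by omega)
  · exact sorted_decided_one_2 d₁ (by omega) d₂ (by omega) d₃ (by omega) d₄ (by omega) d₅ (by omega)
  · exact sorted_decided_one_3 d₁ (by omega) d₂ (by omega) d₃ (by omega) d₄ (by omega) d₅ (by omega)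
  · exact sorted_decided_one_4 d₁ (by omega) d₂ (by omega) d₃ (by omega) d₄ (by omega) d₅ (by omega)
  · exact sorted_decided_one_5 d₁ (by omega) d₂ (by omega) d₃ (by omega) d₄ (by omega) d₅ (by omega)
  · exact sorted_decided_one_6 d₁ (by omega) d₂ (by omega) d₃ (by omega) d₄ (by omega) d₅ (by omega)
  · exact sorted_decided_one_7 d₁ (by omega) d₂ (by omega) d₃ (by omega) d₄ (by omega) d₅ (by omega)
  · exact sorted_decided_one_8 d₁ (by omega) d₂ (by omega) d₃ (by omega) d₄ (by omega) d₅ (by omega)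
  · exact sorted_decided_one_9 d₁ (by omega) d₂ (by omega) d₃ (by omega) d₄ (by omega) d₅ (by omega)
  · exact sorted_decided_one_10 d₁ (by omega) d₂ (by omega) d₃ (by omega) d₄ (by omega) d₅ (by omega)

/-! ### From arbitrary characters to sorted increment tuples -/

/-- The value multiset of a character is unchanged by a permutation of the slots. [folklore] -/
theorem values_comp_perm (b : Fin 6 → ZMod 33) (σ : Equiv.Perm (Fin 6)) :
    univ.val.map (b ∘ σ) = univ.val.map b := by
  rw [← Multiset.map_map, Multiset.map_univ_val_equiv]

/-- Write an element of `ℤ/33` with `val ≡ r (mod 3)` as `3·⌊val/3⌋ + r`. [folklore] -/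
theorem eq_three_mul_div_add (x : ZMod 33) (r : ℕ) (hr : x.val % 3 = r) :
    x = ((3 * (x.val / 3) + r : ℕ) : ZMod 33) := by
  have h : 3 * (x.val / 3) + r = x.val := by rw [← hr]; exact Nat.div_add_mod x.val 3
  rw [h, ZMod.natCast_zmod_val]

/-- REDUCTION: if a property of value multisets holds for `charOfN r (psum6 d)` for all increments with `Σ d ≤ 10` (whenever that
character is Hodge), then it holds for every Hodge character with constant residue `r`. [folklore] -/
theorem of_sorted (r : ℕ) (P : Multiset (ZMod 33) → Prop)
    (hsorted : ∀ d₀ < 11, ∀ d₁ < 11 - d₀, ∀ d₂ < 11 - d₀ - d₁, ∀ d₃ < 11 - d₀ - d₁ - d₂, ∀ d₄ < 11 - d₀ - d₁ - d₂ - d₃,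
      ∀ d₅ < 11 - d₀ - d₁ - d₂ - d₃ - d₄,
        IsHodge (charOfN r (psum6 d₀ d₁ d₂ d₃ d₄ d₅)) → P (univ.val.map (charOfN r (psum6 d₀ d₁ d₂ d₃ d₄ d₅))))
    (b : Fin 6 → ZMod 33) (hH : IsHodge b) (hr : ∀ k, (b k).val % 3 = r) :
    P (univ.val.map b) := by
  -- sort the slots by value
  let σ : Equiv.Perm (Fin 6) := Tuple.sort (fun k ↦ (b k).val)
  have hmono : Monotone ((fun k ↦ (b k).val) ∘ σ) := Tuple.monotone_sort _
  let b' : Fin 6 → ZMod 33 := b ∘ σ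
  have hH' : IsHodge b' := hH.compEquiv σ
  have hr' : ∀ k, (b' k).val % 3 = r := fun k ↦ hr (σ k)
  -- residue indices
  let q : Fin 6 → ℕ := fun k ↦ (b' k).val / 3
  have hq : ∀ i j : Fin 6, i ≤ j → q i ≤ q j := fun i j hij ↦ Nat.div_le_div_right (hmono hij)
  have hq5 : q 5 ≤ 10 := by
    have h33 : (b' 5).val < 33 := (b' 5).val_lt
    change (b' 5).val / 3 ≤ 10
    omega
  have h01 := hq 0 1 (by decide)
  have h12 := hq 1 2 (by decide)
  have h23 := hq 2 3 (by decide)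
  have h34 := hq 3 4 (by decide)
  have h45 := hq 4 5 (by decide)
  -- increments and their partial sums
  have hpsum : psum6 (q 0) (q 1 - q 0) (q 2 - q 1) (q 3 - q 2) (q 4 - q 3) (q 5 - q 4) = q := by
    funext k
    fin_cases k
    · rfl
    · change q 0 + (q 1 - q 0) = q 1; omega
    · change q 0 + (q 1 - q 0) + (q 2 - q 1) = q 2; omega
    · change q 0 + (q 1 - q 0) + (q 2 - q 1) + (q 3 - q 2) = q 3; omega
    · change q 0 + (q 1 - q 0) + (q 2 - q 1) + (q 3 - q 2) + (q 4 - q 3) = q 4; omega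
    · change q 0 + (q 1 - q 0) + (q 2 - q 1) + (q 3 - q 2) + (q 4 - q 3) + (q 5 - q 4) = q 5; omega
  have hchar : charOfN r q = b' := by
    funext k
    exact (eq_three_mul_div_add (b' k) r (hr' k)).symm
  have key := hsorted (q 0) (by omega) (q 1 - q 0) (by omega) (q 2 - q 1) (by omega) (q 3 - q 2) (by omega)
    (q 4 - q 3) (by omega) (q 5 - q 4) (by omega)
  rw [hpsum, hchar] at key
  rw [← values_comp_perm b σ]
  exact key hH'

/-- **C1.** A Hodge character of `X⁴₃₃` (Shioda's criterion at the 20 units of `ℤ/33`) all of whose six entries are `≡ 1 (mod 3)` has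
value multiset in `orbit4`, i.e. is a unit multiple of `a₃₃ = (1,4,16,22,25,31)` up to the order of the slots (CONTROL33 §1 C1,
residue class `1`; the class `2` is the image under `b ↦ −b`). Kernel-checked. [folklore] -/
theorem C1_one (b : Fin 6 → ZMod 33) (hH : IsHodge b) (h1 : ∀ k, (b k).val % 3 = 1) :
    univ.val.map b ∈ orbit4 :=
  of_sorted 1 (· ∈ orbit4) sorted_decided_one b hH h1

/-- `orbit4` is stable under negation (`−1` is a unit of `ℤ/33`). Kernel decision. [folklore] -/
theorem orbit4_neg : ∀ s ∈ orbit4, s.map (fun x ↦ -x) ∈ orbit4 := by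
  unfold orbit4; decide +kernel

/-- **C1 (residue 2).** A Hodge character of `X⁴₃₃` all of whose entries are `≡ 2 (mod 3)` has value multiset in `orbit4`
(apply `C1_one` to `−b`, whose entries are `≡ 1 (mod 3)`, and negate back). Kernel-checked. [folklore] -/
theorem C1_two (b : Fin 6 → ZMod 33) (hH : IsHodge b) (h2 : ∀ k, (b k).val % 3 = 2) :
    univ.val.map b ∈ orbit4 := by
  have hneg : IsHodge (-b) := hH.neg
  have h1 : ∀ k, ((-b) k).val % 3 = 1 := by
    intro k
    have hk := h2 k
    have hne : b k ≠ 0 := hH.1.1 k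
    have hval : ((-b) k).val = 33 - (b k).val := by
      rw [Pi.neg_apply, ZMod.neg_val, if_neg hne]
    have hlt : (b k).val < 33 := (b k).val_lt
    omega
  have h := orbit4_neg _ (C1_one (-b) hneg h1)
  rw [Multiset.map_map] at h
  have hcomp : ((fun x : ZMod 33 ↦ -x) ∘ (-b)) = b := by
    funext k; simp
  rwa [hcomp] at h

/-! ### Residue 0: the 35 pull-backs from `X⁴₁₁` (appended, gen 4) -/

/-- The 35 Hodge multisets of `X⁴₃₃` with all entries `≡ 0 (mod 3)` (CONTROL33 §1, C1′): `3·β` for the 35 Hodge (= pair-type)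
characters `β` of `X⁴₁₁`. [folklore] -/
def pullback35 : Finset (Multiset (ZMod 33)) :=
  {({3, 3, 3, 30, 30, 30} : Multiset (ZMod 33)), {3, 3, 6, 27, 30, 30}, {3, 3, 9, 24, 30, 30}, {3, 3, 12, 21, 30, 30},
   {3, 3, 15, 18, 30, 30}, {3, 6, 6, 27, 27, 30}, {3, 6, 9, 24, 27, 30}, {3, 6, 12, 21, 27, 30}, {3, 6, 15, 18, 27, 30},
   {3, 9, 9, 24, 24, 30}, {3, 9, 12, 21, 24, 30}, {3, 9, 15, 18, 24, 30}, {3, 12, 12, 21, 21, 30}, {3, 12, 15, 18, 21, 30},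
   {3, 15, 15, 18, 18, 30}, {6, 6, 6, 27, 27, 27}, {6, 6, 9, 24, 27, 27}, {6, 6, 12, 21, 27, 27}, {6, 6, 15, 18, 27, 27},
   {6, 9, 9, 24, 24, 27}, {6, 9, 12, 21, 24, 27}, {6, 9, 15, 18, 24, 27}, {6, 12, 12, 21, 21, 27}, {6, 12, 15, 18, 21, 27},
   {6, 15, 15, 18, 18, 27}, {9, 9, 9, 24, 24, 24}, {9, 9, 12, 21, 24, 24}, {9, 9, 15, 18, 24, 24}, {9, 12, 12, 21, 21, 24},
   {9, 12, 15, 18, 21, 24}, {9, 15, 15, 18, 18, 24}, {12, 12, 12, 21, 21, 21}, {12, 12, 15, 18, 21, 21}, {12, 15, 15, 18, 18, 21},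
   {15, 15, 15, 18, 18, 18}}

set_option maxRecDepth 100000 in set_option maxHeartbeats 8000000 in
/-- Every member of `pullback35` is a juxtaposition of three pairs `{x, −x}` (classes of pulled-back planes of `X⁴₁₁`) and has no
unit entry (so `θ = 0`). Kernel decision. [folklore] -/
theorem pullback35_pairs :
    ∀ s ∈ pullback35, (∃ x ∈ s, ∃ y ∈ s, ∃ z ∈ s, s = {x, -x, y, -y, z, -z}) ∧ ∀ a ∈ s, ¬ Nat.Coprime a.val 33 := by
  unfold pullback35; decide +kernel

set_option maxRecDepth 200000 in set_option maxHeartbeats 80000000 in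
set_option synthInstance.maxHeartbeats 2000000 in set_option synthInstance.maxSize 4096 in
/-- Sorted decision, residue 0, first index `q₀ = 0`. Kernel decision. [cite: Shioda1979HodgeFermat, Thm I (1.6)] -/
theorem sorted_decided_zero_0 :
    ∀ d₁ < 11, ∀ d₂ < 11 - d₁, ∀ d₃ < 11 - d₁ - d₂, ∀ d₄ < 11 - d₁ - d₂ - d₃, ∀ d₅ < 11 - d₁ - d₂ - d₃ - d₄,
      IsHodge (charOfN 0 (psum6 0 d₁ d₂ d₃ d₄ d₅)) → univ.val.map (charOfN 0 (psum6 0 d₁ d₂ d₃ d₄ d₅)) ∈ pullback35 := by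
  unfold IsHodge IsAdmissible normSum pullback35 charOfN psum6; decide +kernel

set_option maxRecDepth 200000 in set_option maxHeartbeats 80000000 in
set_option synthInstance.maxHeartbeats 2000000 in set_option synthInstance.maxSize 4096 in
/-- Sorted decision, residue 0, first index `q₀ = 1`. Kernel decision. [cite: Shioda1979HodgeFermat, Thm I (1.6)] -/
theorem sorted_decided_zero_1 :
    ∀ d₁ < 10, ∀ d₂ < 10 - d₁, ∀ d₃ < 10 - d₁ - d₂, ∀ d₄ < 10 - d₁ - d₂ - d₃, ∀ d₅ < 10 - d₁ - d₂ - d₃ - d₄,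
      IsHodge (charOfN 0 (psum6 1 d₁ d₂ d₃ d₄ d₅)) → univ.val.map (charOfN 0 (psum6 1 d₁ d₂ d₃ d₄ d₅)) ∈ pullback35 := by
  unfold IsHodge IsAdmissible normSum pullback35 charOfN psum6; decide +kernel

set_option maxRecDepth 200000 in set_option maxHeartbeats 80000000 in
set_option synthInstance.maxHeartbeats 2000000 in set_option synthInstance.maxSize 4096 in
/-- Sorted decision, residue 0, first index `q₀ = 2`. Kernel decision. [cite: Shioda1979HodgeFermat, Thm I (1.6)] -/
theorem sorted_decided_zero_2 :
    ∀ d₁ < 9, ∀ d₂ < 9 - d₁, ∀ d₃ < 9 - d₁ - d₂, ∀ d₄ < 9 - d₁ - d₂ - d₃, ∀ d₅ < 9 - d₁ - d₂ - d₃ - d₄,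
      IsHodge (charOfN 0 (psum6 2 d₁ d₂ d₃ d₄ d₅)) → univ.val.map (charOfN 0 (psum6 2 d₁ d₂ d₃ d₄ d₅)) ∈ pullback35 := by
  unfold IsHodge IsAdmissible normSum pullback35 charOfN psum6; decide +kernel

set_option maxRecDepth 200000 in set_option maxHeartbeats 80000000 in
set_option synthInstance.maxHeartbeats 2000000 in set_option synthInstance.maxSize 4096 in
/-- Sorted decision, residue 0, first index `q₀ = 3`. Kernel decision. [cite: Shioda1979HodgeFermat, Thm I (1.6)] -/
theorem sorted_decided_zero_3 :
    ∀ d₁ < 8, ∀ d₂ < 8 - d₁, ∀ d₃ < 8 - d₁ - d₂, ∀ d₄ < 8 - d₁ - d₂ - d₃, ∀ d₅ < 8 - d₁ - d₂ - d₃ - d₄,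
      IsHodge (charOfN 0 (psum6 3 d₁ d₂ d₃ d₄ d₅)) → univ.val.map (charOfN 0 (psum6 3 d₁ d₂ d₃ d₄ d₅)) ∈ pullback35 := by
  unfold IsHodge IsAdmissible normSum pullback35 charOfN psum6; decide +kernel

set_option maxRecDepth 200000 in set_option maxHeartbeats 80000000 in
set_option synthInstance.maxHeartbeats 2000000 in set_option synthInstance.maxSize 4096 in
/-- Sorted decision, residue 0, first index `q₀ = 4`. Kernel decision. [cite: Shioda1979HodgeFermat, Thm I (1.6)] -/
theorem sorted_decided_zero_4 :
    ∀ d₁ < 7, ∀ d₂ < 7 - d₁, ∀ d₃ < 7 - d₁ - d₂, ∀ d₄ < 7 - d₁ - d₂ - d₃, ∀ d₅ < 7 - d₁ - d₂ - d₃ - d₄,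
      IsHodge (charOfN 0 (psum6 4 d₁ d₂ d₃ d₄ d₅)) → univ.val.map (charOfN 0 (psum6 4 d₁ d₂ d₃ d₄ d₅)) ∈ pullback35 := by
  unfold IsHodge IsAdmissible normSum pullback35 charOfN psum6; decide +kernel

set_option maxRecDepth 200000 in set_option maxHeartbeats 80000000 in
set_option synthInstance.maxHeartbeats 2000000 in set_option synthInstance.maxSize 4096 in
/-- Sorted decision, residue 0, first index `q₀ = 5`. Kernel decision. [cite: Shioda1979HodgeFermat, Thm I (1.6)] -/
theorem sorted_decided_zero_5 :
    ∀ d₁ < 6, ∀ d₂ < 6 - d₁, ∀ d₃ < 6 - d₁ - d₂, ∀ d₄ < 6 - d₁ - d₂ - d₃, ∀ d₅ < 6 - d₁ - d₂ - d₃ - d₄,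
      IsHodge (charOfN 0 (psum6 5 d₁ d₂ d₃ d₄ d₅)) → univ.val.map (charOfN 0 (psum6 5 d₁ d₂ d₃ d₄ d₅)) ∈ pullback35 := by
  unfold IsHodge IsAdmissible normSum pullback35 charOfN psum6; decide +kernel

set_option maxRecDepth 200000 in set_option maxHeartbeats 80000000 in
set_option synthInstance.maxHeartbeats 2000000 in set_option synthInstance.maxSize 4096 in
/-- Sorted decision, residue 0, first index `q₀ = 6`. Kernel decision. [cite: Shioda1979HodgeFermat, Thm I (1.6)] -/
theorem sorted_decided_zero_6 :
    ∀ d₁ < 5, ∀ d₂ < 5 - d₁, ∀ d₃ < 5 - d₁ - d₂, ∀ d₄ < 5 - d₁ - d₂ - d₃, ∀ d₅ < 5 - d₁ - d₂ - d₃ - d₄,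
      IsHodge (charOfN 0 (psum6 6 d₁ d₂ d₃ d₄ d₅)) → univ.val.map (charOfN 0 (psum6 6 d₁ d₂ d₃ d₄ d₅)) ∈ pullback35 := by
  unfold IsHodge IsAdmissible normSum pullback35 charOfN psum6; decide +kernel

set_option maxRecDepth 200000 in set_option maxHeartbeats 80000000 in
set_option synthInstance.maxHeartbeats 2000000 in set_option synthInstance.maxSize 4096 in
/-- Sorted decision, residue 0, first index `q₀ = 7`. Kernel decision. [cite: Shioda1979HodgeFermat, Thm I (1.6)] -/
theorem sorted_decided_zero_7 :
    ∀ d₁ < 4, ∀ d₂ < 4 - d₁, ∀ d₃ < 4 - d₁ - d₂, ∀ d₄ < 4 - d₁ - d₂ - d₃, ∀ d₅ < 4 - d₁ - d₂ - d₃ - d₄,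
      IsHodge (charOfN 0 (psum6 7 d₁ d₂ d₃ d₄ d₅)) → univ.val.map (charOfN 0 (psum6 7 d₁ d₂ d₃ d₄ d₅)) ∈ pullback35 := by
  unfold IsHodge IsAdmissible normSum pullback35 charOfN psum6; decide +kernel

set_option maxRecDepth 200000 in set_option maxHeartbeats 80000000 in
set_option synthInstance.maxHeartbeats 2000000 in set_option synthInstance.maxSize 4096 in
/-- Sorted decision, residue 0, first index `q₀ = 8`. Kernel decision. [cite: Shioda1979HodgeFermat, Thm I (1.6)] -/
theorem sorted_decided_zero_8 :
    ∀ d₁ < 3, ∀ d₂ < 3 - d₁, ∀ d₃ < 3 - d₁ - d₂, ∀ d₄ < 3 - d₁ - d₂ - d₃, ∀ d₅ < 3 - d₁ - d₂ - d₃ - d₄,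
      IsHodge (charOfN 0 (psum6 8 d₁ d₂ d₃ d₄ d₅)) → univ.val.map (charOfN 0 (psum6 8 d₁ d₂ d₃ d₄ d₅)) ∈ pullback35 := by
  unfold IsHodge IsAdmissible normSum pullback35 charOfN psum6; decide +kernel

set_option maxRecDepth 200000 in set_option maxHeartbeats 80000000 in
set_option synthInstance.maxHeartbeats 2000000 in set_option synthInstance.maxSize 4096 in
/-- Sorted decision, residue 0, first index `q₀ = 9`. Kernel decision. [cite: Shioda1979HodgeFermat, Thm I (1.6)] -/
theorem sorted_decided_zero_9 :
    ∀ d₁ < 2, ∀ d₂ < 2 - d₁, ∀ d₃ < 2 - d₁ - d₂, ∀ d₄ < 2 - d₁ - d₂ - d₃, ∀ d₅ < 2 - d₁ - d₂ - d₃ - d₄,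
      IsHodge (charOfN 0 (psum6 9 d₁ d₂ d₃ d₄ d₅)) → univ.val.map (charOfN 0 (psum6 9 d₁ d₂ d₃ d₄ d₅)) ∈ pullback35 := by
  unfold IsHodge IsAdmissible normSum pullback35 charOfN psum6; decide +kernel

set_option maxRecDepth 200000 in set_option maxHeartbeats 80000000 in
set_option synthInstance.maxHeartbeats 2000000 in set_option synthInstance.maxSize 4096 in
/-- Sorted decision, residue 0, first index `q₀ = 10`. Kernel decision. [cite: Shioda1979HodgeFermat, Thm I (1.6)] -/
theorem sorted_decided_zero_10 :
    ∀ d₁ < 1, ∀ d₂ < 1 - d₁, ∀ d₃ < 1 - d₁ - d₂, ∀ d₄ < 1 - d₁ - d₂ - d₃, ∀ d₅ < 1 - d₁ - d₂ - d₃ - d₄,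
      IsHodge (charOfN 0 (psum6 10 d₁ d₂ d₃ d₄ d₅)) → univ.val.map (charOfN 0 (psum6 10 d₁ d₂ d₃ d₄ d₅)) ∈ pullback35 := by
  unfold IsHodge IsAdmissible normSum pullback35 charOfN psum6; decide +kernel

set_option maxHeartbeats 8000000 in
/-- SORTED DECISION, residue 0, assembled from the eleven pieces. [cite: Shioda1979HodgeFermat, Thm I (1.6)] -/
theorem sorted_decided_zero :
    ∀ d₀ < 11, ∀ d₁ < 11 - d₀, ∀ d₂ < 11 - d₀ - d₁, ∀ d₃ < 11 - d₀ - d₁ - d₂, ∀ d₄ < 11 - d₀ - d₁ - d₂ - d₃,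
      ∀ d₅ < 11 - d₀ - d₁ - d₂ - d₃ - d₄,
        IsHodge (charOfN 0 (psum6 d₀ d₁ d₂ d₃ d₄ d₅)) → univ.val.map (charOfN 0 (psum6 d₀ d₁ d₂ d₃ d₄ d₅)) ∈ pullback35 := by
  intro d₀ hd₀ d₁ hd₁ d₂ hd₂ d₃ hd₃ d₄ hd₄ d₅ hd₅
  interval_cases d₀
  · exact sorted_decided_zero_0 d₁ (by omega) d₂ (by omega) d₃ (by omega) d₄ (by omega) d₅ (by omega)
  · exact sorted_decided_zero_1 d₁ (by omega) d₂ (by omega) d₃ (by omega) d₄ (by omega) d₅ (by omega)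
  · exact sorted_decided_zero_2 d₁ (by omega) d₂ (by omega) d₃ (by omega) d₄ (by omega) d₅ (by omega)
  · exact sorted_decided_zero_3 d₁ (by omega) d₂ (by omega) d₃ (by omega) d₄ (by omega) d₅ (by omega)
  · exact sorted_decided_zero_4 d₁ (by omega) d₂ (by omega) d₃ (by omega) d₄ (by omega) d₅ (by omega)
  · exact sorted_decided_zero_5 d₁ (by omega) d₂ (by omega) d₃ (by omega) d₄ (by omega) d₅ (by omega)
  · exact sorted_decided_zero_6 d₁ (by omega) d₂ (by omega) d₃ (by omega) d₄ (by omega) d₅ (by omega)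
  · exact sorted_decided_zero_7 d₁ (by omega) d₂ (by omega) d₃ (by omega) d₄ (by omega) d₅ (by omega)
  · exact sorted_decided_zero_8 d₁ (by omega) d₂ (by omega) d₃ (by omega) d₄ (by omega) d₅ (by omega)
  · exact sorted_decided_zero_9 d₁ (by omega) d₂ (by omega) d₃ (by omega) d₄ (by omega) d₅ (by omega)
  · exact sorted_decided_zero_10 d₁ (by omega) d₂ (by omega) d₃ (by omega) d₄ (by omega) d₅ (by omega)

/-- **C1′ (residue 0).** A Hodge character of `X⁴₃₃` all of whose entries are `≡ 0 (mod 3)` has value multiset among the 35 pair-type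
pull-backs `pullback35` (each three pairs `{x,−x}`, no unit entry — `pullback35_pairs`). Kernel-checked. [folklore] -/
theorem C1_zero (b : Fin 6 → ZMod 33) (hH : IsHodge b) (h0 : ∀ k, (b k).val % 3 = 0) :
    univ.val.map b ∈ pullback35 :=
  of_sorted 0 (· ∈ pullback35) sorted_decided_zero b hH h0

end Summit.HodgeConjecture.FermatCycles.KummerSupportThirtyThreeC1
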